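import Summits.ResolutionOfSingularities.ResolutionOfSingularities.Theorems.FrobeniusClosingPatchingRelPerfectSigmaCalculusPrelim
import HarnessLib

/-!
# Crux `PatchingRelPerfect` (stmt-ResolutionOfSingularities-16161), chain w52 — rung tool r2Σ-a,
# part 2: the charts of the blown-up suspension (CORE-MECHANISM-NOTE §3a, COORDINATE centres)

[OURS · L1 W5.2 · rung tool] Setting of part 1 (`…SigmaCalculusPrelim.lean`): variables
`σ = Option (Option τ)`, `s = none`, `u = some none`, base `t ↦ some (some t)`; `G = rename base g`;
the suspension `Σ(G) = Spec S[X_σ]/(G - X_u X_s)`; a COORDINATE centre `C = V(X_j : j ∈ A₀)`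
lifted to `C × {u = s = 0}` with ideal `P = (X_i : i ∈ centre)`.  PROVED here, for any domain `S`
and in every dimension, as ring isomorphisms of affine blowup algebras (`blowupAlgebra`, Proj-free;
stated as `Nonempty`, no definitions):

* `nonempty_baseChartEquiv` — **chart of a centre coordinate** `w = X_{base j₀}`: if the chart
  transform of `g` is `X_{j₀}^{μ+2} · g′` (true for `g ∈ (X_j : j ∈ A₀)^{μ+2}`, part 1), the chart
  ring of `Bl_P Σ(G)` over `w̄` is `S[X_σ] ⧸ (w^μ · rename base g′ - X_u X_s)` = the suspension
  `Σ(w^{ν-2} G′)`, `ν = μ + 2` — the planner's §3a;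
* `nonempty_uChartEquiv`, `nonempty_uChartEquivMvPolynomial`, `isRegularRing_uChart` and the
  `s`-versions — **the `u`- and `s`-charts are graphs** `S[X_σ] ⧸ (X_s - X_u^μ G̃) ≅ S[X_{Option τ}]`,
  regular for `S` regular and `τ` finite.

Mechanism: the ambient chart is `S[X_σ]` again with structure map Hu's substitution
(`coordBlowupChartEquiv`); the total transform of `G - X_u X_s` is `X_{i₀}² · f′`; `X_{i₀}` is prime
(`MvPolynomial.X_prime`) and `∤ f′` (part 1), so the blown-up hypersurface's chart ring is
`S[X_σ]/(f′)` (`blowupAlgebra.quotientKerMapQuotientEquiv`, GW Prop. 13.96 (2)).  HONEST SCOPE: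
coordinate centres only; gluing is that of `affineBlowup`'s Rees charts; the NOTE's (2a)–(2c),
(3b)–(3c) are not touched.  Nothing here is a statement of the manuscript under review.

## References

* U. Görtz, T. Wedhorn, *Algebraic Geometry I* (2nd ed., 2020), Prop. 13.96 (2), p. 416. [GortzWedhorn2020]
* Y. Hu, arXiv:2507.21400 (2025), §5 Prop. 5.3. [Hu2025]
* A. J. de Jong, Publ. Math. IHÉS 83 (1996), 3.4 and 4.27 (the computation for `uv = ∏ tᵢ^{νᵢ}`). [DeJong1996]
-/

-- `Summit.<Summit>.<Sub>.Theorems` with `Sub = Summit` (single-conjunct summit, D-0017)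
set_option linter.dupNamespace false

noncomputable section

open MvPolynomial Literature.AlgebraicGeometry.Resolution

namespace Summit.ResolutionOfSingularities.ResolutionOfSingularities.Theorems

namespace SigmaCalculus

universe u v

variable (S : Type u) [CommRing S] {τ : Type v}

section Setting

variable (A₀ : Set τ)

local notation3 "base" => (fun t : τ => (some (some t) : Option (Option τ)))
local notation3 "centre" =>
  insert none (insert (some none) ((fun t : τ => (some (some t) : Option (Option τ))) '' A₀))

/-! ## The chart of a centre coordinate: `Σ(G)` becomes `Σ(w^{ν-2} G′)` -/

section BaseChart

variable {S} [IsDomain S] {j₀ : τ} {g g' : MvPolynomial τ S} {μ : ℕ}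
  (hg' : coordBlowupSubst S A₀ j₀ g = X j₀ ^ (μ + 2) * g')

local notation3 "R" => MvPolynomial (Option (Option τ)) S
local notation3 "P" => Ideal.span (X '' (centre) : Set (MvPolynomial (Option (Option τ)) S))
local notation3 "w" => (X (some (some j₀)) : MvPolynomial (Option (Option τ)) S)
local notation3 "Heq" => (rename base g - X (some none) * X none : MvPolynomial (Option (Option τ)) S)

omit [IsDomain S] in
include hg' in
/-- The total transform of the suspension equation on the chart of `w = X_{base j₀}`:
`subst (G - X_u X_s) = w² · (w^μ G′ - X_u X_s)`. [cite: Hu2025, §5 Prop. 5.3] -/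
theorem coordBlowupSubst_base_suspEq :
    coordBlowupSubst S (centre) (base j₀) Heq =
      w ^ 2 * (w ^ μ * rename base g' - X (some none) * X none) := by
  have hu : coordBlowupSubst S (centre) (base j₀) (X (some none)) = w * X (some none) :=
    coordBlowupSubst_X_of_mem_of_ne S _ _ (some_none_mem_centre A₀) (some_some_ne_some_none j₀).symm
  have hs : coordBlowupSubst S (centre) (base j₀) (X none) = w * X none :=
    coordBlowupSubst_X_of_mem_of_ne S _ _ (none_mem_centre A₀) (some_some_ne_none j₀).symm
  rw [map_sub, map_mul, hu, hs, coordBlowupSubst_base_rename, hg', map_mul, map_pow,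
    rename_X]
  change w ^ (μ + 2) * rename base g' - w * X (some none) * (w * X none) = _
  ring

include hg' in
/-- **r2Σ-a, chart of a centre coordinate (CORE-MECHANISM-NOTE §3a).** For a domain `S`, a
coordinate centre `C = V(X_j : j ∈ A₀)` of `S[X_τ]`, `j₀ ∈ A₀`, and `g` whose chart transform on
the chart of `X_{j₀}` is `X_{j₀}^{μ+2} · g′` (e.g. any `g ∈ (X_j : j ∈ A₀)^{μ+2}`), the chart ring,
over `w̄ = X̄_{base j₀}`, of the blow-up of the suspension `Spec S[X_σ]/(G - X_u X_s)`
(`G = rename base g`) along the lifted centre `C × {u = s = 0}` is the suspension of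
`w^μ · G′`: `(S[X_σ]/(G - X_u X_s))[P̄/w̄] ≅ S[X_σ] ⧸ (w^μ · rename base g′ - X_u X_s)`.
The blow-up of the hypersurface is computed by the strict transform of its equation
(GW Prop. 13.96 (2): `w` is prime in the chart ring `S[X_σ][P/w] ≅ S[X_σ]` and does not divide the
strict transform, whose `X_u X_s`-coefficient is `-1`).
[cite: GortzWedhorn2020, Prop. 13.96 (2) and p. 416] [cite: Hu2025, §5 Prop. 5.3] -/
theorem nonempty_baseChartEquiv :
    Nonempty (blowupAlgebra ((P).map (Ideal.Quotient.mk (Ideal.span {Heq})))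
        (Ideal.Quotient.mk (Ideal.span {Heq}) w) ≃+*
      (R) ⧸ Ideal.span {w ^ μ * rename base g' - X (some none) * X none}) := by
  classical
  let e := coordBlowupChartEquiv S (centre) (base j₀)
  let f₀ : R := w ^ μ * rename base g' - X (some none) * X none
  let f' : blowupAlgebra (P) w := e f₀
  have hsymm : ∀ p : R, e.symm (algebraMap R (blowupAlgebra (P) w) p) =
      coordBlowupSubst S (centre) (base j₀) p :=
    coordBlowupChartEquiv_symm_algebraMap S (centre) (base j₀)
  have hf : algebraMap R (blowupAlgebra (P) w) Heq =
      algebraMap R (blowupAlgebra (P) w) w ^ 2 * f' := by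
    apply e.symm.injective
    rw [hsymm, map_mul, map_pow, hsymm, coordBlowupSubst_X_self, AlgEquiv.symm_apply_apply,
      coordBlowupSubst_base_suspEq A₀ hg']
  have hprime : Prime (algebraMap R (blowupAlgebra (P) w) w) := by
    have h : Prime (e.symm (algebraMap R (blowupAlgebra (P) w) w)) := by
      rw [hsymm, coordBlowupSubst_X_self]
      exact MvPolynomial.X_prime
    exact (MulEquiv.prime_iff e.symm).mp h
  have hndvd : ¬ algebraMap R (blowupAlgebra (P) w) w ∣ f' := by
    intro hdvd
    have h := map_dvd (e.symm : blowupAlgebra (P) w →+* R) hdvd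
    rw [RingHom.coe_coe, hsymm, coordBlowupSubst_X_self, AlgEquiv.symm_apply_apply] at h
    exact not_X_base_dvd S j₀ μ g' h
  let E₁ := blowupAlgebra.quotientKerMapQuotientEquiv (P) w hf hprime hndvd
  have hmap : Ideal.span {f'} = (Ideal.span {f₀}).map (e.toRingEquiv : R →+* _) := by
    rw [Ideal.map_span, Set.image_singleton]
    rfl
  let E₀ := Ideal.quotientEquiv (Ideal.span {f₀}) (Ideal.span {f'}) e.toRingEquiv hmap
  exact ⟨(E₀.trans E₁).symm⟩

end BaseChart

/-! ## The `u`-chart: a graph, hence regular -/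

section UChart

variable {S} [IsDomain S] {g : MvPolynomial τ S} {Gt : MvPolynomial (Option τ) S}
  {μ : ℕ}
  (hGt : coordBlowupSubst S (insert none (some '' A₀)) none (rename some g) = X none ^ (μ + 2) * Gt)

local notation3 "R" => MvPolynomial (Option (Option τ)) S
local notation3 "P" => Ideal.span (X '' (centre) : Set (MvPolynomial (Option (Option τ)) S))
local notation3 "xu" => (X (some none) : MvPolynomial (Option (Option τ)) S)
local notation3 "Heq" => (rename base g - X (some none) * X none : MvPolynomial (Option (Option τ)) S)

omit [IsDomain S] in
include hGt in
/-- The total transform of the suspension equation on the `u`-chart: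
`subst (G - X_u X_s) = X_u² · (X_u^μ G̃ - X_s)`, `G̃ = rename some Gt`. [cite: Hu2025, §5 Prop. 5.3] -/
theorem coordBlowupSubst_u_suspEq :
    coordBlowupSubst S (centre) (some none) Heq =
      xu ^ 2 * (xu ^ μ * rename some Gt - X none) := by
  have hs : coordBlowupSubst S (centre) (some none) (X none) = xu * X none :=
    coordBlowupSubst_X_of_mem_of_ne S _ _ (none_mem_centre A₀) (by simp)
  rw [map_sub, map_mul, hs, coordBlowupSubst_X_self, coordBlowupSubst_u_rename, hGt,
    map_mul, map_pow, rename_X]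
  ring

include hGt in
/-- **r2Σ-a, the `u`-chart (CORE-MECHANISM-NOTE §3a).** For a domain `S`, a coordinate centre
`C = V(X_j : j ∈ A₀)` and `g` whose lifted chart transform on the chart of `u` is
`X_u^{μ+2} · G̃` (any `g ∈ (X_j : j ∈ A₀)^{μ+2}`, `exists_coordBlowupSubst_eq_pow_mul` with
`rename_some_mem_pow`), the chart ring over `ū` of the blow-up of the suspension
`Spec S[X_σ]/(G - X_u X_s)` along `C × {u = s = 0}` is the GRAPH
`S[X_σ] ⧸ (X_s - X_u^μ · G̃)`. [cite: GortzWedhorn2020, Prop. 13.96 (2) and p. 416]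
[cite: Hu2025, §5 Prop. 5.3] -/
theorem nonempty_uChartEquiv :
    Nonempty (blowupAlgebra ((P).map (Ideal.Quotient.mk (Ideal.span {Heq})))
        (Ideal.Quotient.mk (Ideal.span {Heq}) xu) ≃+*
      (R) ⧸ Ideal.span {X none - rename some (X none ^ μ * Gt)}) := by
  classical
  let e := coordBlowupChartEquiv S (centre) (some none : Option (Option τ))
  let f₀ : R := xu ^ μ * rename some Gt - X none
  let f' : blowupAlgebra (P) xu := e f₀
  have hsymm : ∀ p : R, e.symm (algebraMap R (blowupAlgebra (P) xu) p) =
      coordBlowupSubst S (centre) (some none) p :=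
    coordBlowupChartEquiv_symm_algebraMap S (centre) (some none)
  have hf : algebraMap R (blowupAlgebra (P) xu) Heq =
      algebraMap R (blowupAlgebra (P) xu) xu ^ 2 * f' := by
    apply e.symm.injective
    rw [hsymm, map_mul, map_pow, hsymm, coordBlowupSubst_X_self, AlgEquiv.symm_apply_apply,
      coordBlowupSubst_u_suspEq A₀ hGt]
  have hprime : Prime (algebraMap R (blowupAlgebra (P) xu) xu) := by
    have h : Prime (e.symm (algebraMap R (blowupAlgebra (P) xu) xu)) := by
      rw [hsymm, coordBlowupSubst_X_self]
      exact MvPolynomial.X_prime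
    exact (MulEquiv.prime_iff e.symm).mp h
  have hndvd : ¬ algebraMap R (blowupAlgebra (P) xu) xu ∣ f' := by
    intro hdvd
    have h := map_dvd (e.symm : blowupAlgebra (P) xu →+* R) hdvd
    rw [RingHom.coe_coe, hsymm, coordBlowupSubst_X_self, AlgEquiv.symm_apply_apply] at h
    exact not_X_u_dvd S μ Gt h
  let E₁ := blowupAlgebra.quotientKerMapQuotientEquiv (P) xu hf hprime hndvd
  have hmap : Ideal.span {f'} = (Ideal.span {f₀}).map (e.toRingEquiv : R →+* _) := by
    rw [Ideal.map_span, Set.image_singleton]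
    rfl
  let E₀ := Ideal.quotientEquiv (Ideal.span {f₀}) (Ideal.span {f'}) e.toRingEquiv hmap
  have hspan : Ideal.span {f₀} = Ideal.span {X none - rename some (X none ^ μ * Gt)} := by
    have hneg : f₀ = -(X none - rename some (X none ^ μ * Gt)) := by
      simp only [f₀, map_mul, map_pow, rename_X]
      ring
    rw [hneg, Ideal.span_singleton_neg]
  rw [hspan] at E₀
  exact ⟨(E₀.trans E₁).symm⟩

include hGt in
/-- **The `u`-chart is an affine space**: its chart ring is `≅ S[X_{Option τ}]` (eliminate
`X_s = X_u^μ G̃`). [cite: Hu2025, §5 Prop. 5.3] -/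
theorem nonempty_uChartEquivMvPolynomial :
    Nonempty (blowupAlgebra ((P).map (Ideal.Quotient.mk (Ideal.span {Heq})))
        (Ideal.Quotient.mk (Ideal.span {Heq}) xu) ≃+* MvPolynomial (Option τ) S) := by
  obtain ⟨E⟩ := nonempty_uChartEquiv A₀ hGt
  obtain ⟨E'⟩ := nonempty_quotientGraphEquiv S (X none ^ μ * Gt)
  exact ⟨E.trans E'⟩

include hGt in
/-- **The `u`-chart is regular** when `S` is a regular ring (e.g. a field) and `τ` is finite.
[cite: GortzWedhorn2020, Prop. 13.96 (2) and p. 416] -/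
theorem isRegularRing_uChart [IsRegularRing S] [Finite τ] :
    IsRegularRing (blowupAlgebra ((P).map (Ideal.Quotient.mk (Ideal.span {Heq})))
        (Ideal.Quotient.mk (Ideal.span {Heq}) xu)) := by
  obtain ⟨E⟩ := nonempty_uChartEquivMvPolynomial A₀ hGt
  exact IsRegularRing.of_ringEquiv E.symm

end UChart

/-! ## The `s`-chart (symmetric to the `u`-chart under `u ↔ s`) -/

/-- On base polynomials, the substitution of the `s`-chart (`s = none`) for the lifted centre is
the same downstairs substitution as for the `u`-chart, transported along
`rename (Option.map some)` (`none ↦ none = s`, `some t ↦ base t`). [folklore] -/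
theorem coordBlowupSubst_s_rename (p : MvPolynomial τ S) :
    coordBlowupSubst S (centre) none (rename base p) =
      rename (Option.map some)
        (coordBlowupSubst S (insert none (some '' A₀)) none (rename some p)) := by
  classical
  have h : (coordBlowupSubst S (centre) none).comp (rename base) =
      ((rename (Option.map some)).comp (coordBlowupSubst S (insert none (some '' A₀)) none)).comp
        (rename some) := by
    apply MvPolynomial.algHom_ext
    intro t
    have h1 : (some t : Option τ) ∈ insert none (some '' A₀) ↔ t ∈ A₀ := by
      simp only [Set.mem_insert_iff, reduceCtorEq, false_or]
      exact (Option.some_injective _).mem_set_image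
    simp only [AlgHom.comp_apply, rename_X, coordBlowupSubst_X, some_some_mem_centre_iff, h1]
    split_ifs with h2 h3 h3 <;> simp_all
  exact congrArg (fun φ : MvPolynomial τ S →ₐ[S] _ => φ p) h

/-- **`X_s ∤ X_s^μ · G̃ˢ - X_u`** for `G̃ˢ` in the image of `rename (Option.map some)` (free of
`u`): the coefficient of `X_u`. [folklore] -/
theorem not_X_s_dvd [Nontrivial S] (μ : ℕ) (p : MvPolynomial (Option τ) S) :
    ¬ (X none : MvPolynomial (Option (Option τ)) S) ∣
      X none ^ μ * rename (Option.map some) p - X (some none) := by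
  classical
  rintro ⟨h, hh⟩
  let m₁ : Option (Option τ) →₀ ℕ := Finsupp.single (some none) 1
  have h1 : coeff m₁ (X none * h) = 0 := by
    rw [coeff_X_mul', if_neg]
    simp [m₁]
  have h2 : coeff m₁ (X none ^ μ * rename (Option.map some) p) = 0 := by
    have hr : X none ^ μ * rename (Option.map some) p =
        rename (Option.map some : Option τ → Option (Option τ)) (X none ^ μ * p) := by
      simp only [map_mul, map_pow, rename_X, Option.map_none]
    rw [hr]
    refine coeff_rename_eq_zero_of_ne_zero S (Option.map some) _ m₁ (k := some none) ?_ ?_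
    · rintro ⟨x, hx⟩
      cases x with
      | none => simp at hx
      | some t => simp at hx
    · simp [m₁]
  have h3 : coeff m₁ (X (some none) : MvPolynomial (Option (Option τ)) S) = 1 := by
    rw [coeff_X, if_pos rfl]
  have h4 := congrArg (coeff m₁) hh
  rw [coeff_sub, h2, h3, h1, zero_sub] at h4
  exact one_ne_zero (neg_eq_zero.mp h4)

/-- The graph quotient in the variable `u = some none`: transport of `nonempty_quotientGraphEquiv`
along the swap `u ↔ s` of the variables (`swap ∘ Option.map some = some`). [folklore] -/
theorem nonempty_quotientGraphEquiv_u (Q : MvPolynomial (Option τ) S) :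
    Nonempty ((MvPolynomial (Option (Option τ)) S ⧸
        Ideal.span {X (some none) - rename (Option.map some) Q}) ≃+* MvPolynomial (Option τ) S) := by
  classical
  let θ := MvPolynomial.renameEquiv S (Equiv.swap (none : Option (Option τ)) (some none))
  have hθ : θ (X (some none) - rename (Option.map some) Q) = X none - rename some Q := by
    have hcomp : (rename (Equiv.swap (none : Option (Option τ)) (some none))).comp
        (rename (Option.map some)) =
        (rename (some : Option τ → Option (Option τ)) :
          MvPolynomial (Option τ) S →ₐ[S] MvPolynomial (Option (Option τ)) S) := by
      apply MvPolynomial.algHom_ext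
      intro x
      cases x with
      | none => simp [Equiv.swap_apply_left]
      | some t => simp [Equiv.swap_apply_of_ne_of_ne]
    have h1 : θ (rename (Option.map some) Q) = rename some Q := by
      change rename _ (rename (Option.map some) Q) = _
      exact congrArg (fun φ : MvPolynomial (Option τ) S →ₐ[S] _ => φ Q) hcomp
    rw [map_sub, h1]
    change rename _ (X (some none)) - _ = _
    rw [rename_X, Equiv.swap_apply_right]
  obtain ⟨E'⟩ := nonempty_quotientGraphEquiv S Q
  refine ⟨(Ideal.quotientEquiv (Ideal.span {X (some none) - rename (Option.map some) Q})
    (Ideal.span {X none - rename some Q}) θ.toRingEquiv ?_).trans E'⟩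
  rw [Ideal.map_span, Set.image_singleton]
  congr 2
  exact hθ.symm

section SChart

variable {S} [IsDomain S] {g : MvPolynomial τ S} {Gt : MvPolynomial (Option τ) S}
  {μ : ℕ}
  (hGt : coordBlowupSubst S (insert none (some '' A₀)) none (rename some g) = X none ^ (μ + 2) * Gt)

local notation3 "R" => MvPolynomial (Option (Option τ)) S
local notation3 "P" => Ideal.span (X '' (centre) : Set (MvPolynomial (Option (Option τ)) S))
local notation3 "xs" => (X none : MvPolynomial (Option (Option τ)) S)
local notation3 "Heq" => (rename base g - X (some none) * X none : MvPolynomial (Option (Option τ)) S)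

omit [IsDomain S] in
include hGt in
/-- The total transform of the suspension equation on the `s`-chart:
`subst (G - X_u X_s) = X_s² · (X_s^μ G̃ˢ - X_u)`. [cite: Hu2025, §5 Prop. 5.3] -/
theorem coordBlowupSubst_s_suspEq :
    coordBlowupSubst S (centre) none Heq =
      xs ^ 2 * (xs ^ μ * rename (Option.map some) Gt - X (some none)) := by
  have hu : coordBlowupSubst S (centre) none (X (some none)) = xs * X (some none) :=
    coordBlowupSubst_X_of_mem_of_ne S _ _ (some_none_mem_centre A₀) (by simp)
  rw [map_sub, map_mul, hu, coordBlowupSubst_X_self, coordBlowupSubst_s_rename, hGt,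
    map_mul, map_pow, rename_X, Option.map_none]
  ring

include hGt in
/-- **r2Σ-a, the `s`-chart** (symmetric to the `u`-chart): the chart ring over `s̄` of the
blow-up of the suspension along `C × {u = s = 0}` is the graph `S[X_σ] ⧸ (X_u - X_s^μ · G̃ˢ)`.
[cite: GortzWedhorn2020, Prop. 13.96 (2) and p. 416] [cite: Hu2025, §5 Prop. 5.3] -/
theorem nonempty_sChartEquiv :
    Nonempty (blowupAlgebra ((P).map (Ideal.Quotient.mk (Ideal.span {Heq})))
        (Ideal.Quotient.mk (Ideal.span {Heq}) xs) ≃+*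
      (R) ⧸ Ideal.span {X (some none) - rename (Option.map some) (X none ^ μ * Gt)}) := by
  classical
  let e := coordBlowupChartEquiv S (centre) (none : Option (Option τ))
  let f₀ : R := xs ^ μ * rename (Option.map some) Gt - X (some none)
  let f' : blowupAlgebra (P) xs := e f₀
  have hsymm : ∀ p : R, e.symm (algebraMap R (blowupAlgebra (P) xs) p) =
      coordBlowupSubst S (centre) none p :=
    coordBlowupChartEquiv_symm_algebraMap S (centre) none
  have hf : algebraMap R (blowupAlgebra (P) xs) Heq =
      algebraMap R (blowupAlgebra (P) xs) xs ^ 2 * f' := by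
    apply e.symm.injective
    rw [hsymm, map_mul, map_pow, hsymm, coordBlowupSubst_X_self, AlgEquiv.symm_apply_apply,
      coordBlowupSubst_s_suspEq A₀ hGt]
  have hprime : Prime (algebraMap R (blowupAlgebra (P) xs) xs) := by
    have h : Prime (e.symm (algebraMap R (blowupAlgebra (P) xs) xs)) := by
      rw [hsymm, coordBlowupSubst_X_self]
      exact MvPolynomial.X_prime
    exact (MulEquiv.prime_iff e.symm).mp h
  have hndvd : ¬ algebraMap R (blowupAlgebra (P) xs) xs ∣ f' := by
    intro hdvd
    have h := map_dvd (e.symm : blowupAlgebra (P) xs →+* R) hdvd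
    rw [RingHom.coe_coe, hsymm, coordBlowupSubst_X_self, AlgEquiv.symm_apply_apply] at h
    exact not_X_s_dvd S μ Gt h
  let E₁ := blowupAlgebra.quotientKerMapQuotientEquiv (P) xs hf hprime hndvd
  have hmap : Ideal.span {f'} = (Ideal.span {f₀}).map (e.toRingEquiv : R →+* _) := by
    rw [Ideal.map_span, Set.image_singleton]
    rfl
  let E₀ := Ideal.quotientEquiv (Ideal.span {f₀}) (Ideal.span {f'}) e.toRingEquiv hmap
  have hspan : Ideal.span {f₀} =
      Ideal.span {X (some none) - rename (Option.map some) (X none ^ μ * Gt)} := by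
    have hneg : f₀ = -(X (some none) - rename (Option.map some) (X none ^ μ * Gt)) := by
      simp only [f₀, map_mul, map_pow, rename_X, Option.map_none]
      ring
    rw [hneg, Ideal.span_singleton_neg]
  rw [hspan] at E₀
  exact ⟨(E₀.trans E₁).symm⟩

include hGt in
/-- **The `s`-chart is an affine space `≅ S[X_{Option τ}]`, hence regular** for `S` regular and
`τ` finite. [cite: GortzWedhorn2020, Prop. 13.96 (2) and p. 416] [cite: Hu2025, §5 Prop. 5.3] -/
theorem isRegularRing_sChart [IsRegularRing S] [Finite τ] :
    IsRegularRing (blowupAlgebra ((P).map (Ideal.Quotient.mk (Ideal.span {Heq})))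
        (Ideal.Quotient.mk (Ideal.span {Heq}) xs)) := by
  obtain ⟨E⟩ := nonempty_sChartEquiv A₀ hGt
  obtain ⟨E'⟩ := nonempty_quotientGraphEquiv_u S (X none ^ μ * Gt)
  exact IsRegularRing.of_ringEquiv (E.trans E').symm

end SChart

end Setting

end SigmaCalculus

end Summit.ResolutionOfSingularities.ResolutionOfSingularities.Theorems

end
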